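import Summits.BirchSwinnertonDyer.BirchSwinnertonDyer.Theses.FrozenTwin
import Summits.BirchSwinnertonDyer.BirchSwinnertonDyer.Theorems.PGSelmerBSD.Negative.AdmissiblePrimeFalse
import Literature.NumberTheory.EllipticCurves.BSDSelmerParityDokchitserProofs
import Literature.NumberTheory.EllipticCurves.BSDSelmerCMPConverseKLevelProofs

/-!
# BirchSwinnertonDyer / FrozenTwin — crux `UBPotentiallyGood` (stmt-BirchSwinnertonDyer-15878):
# negative lemmas — the crux is VACUOUS on CM curves, no hypothesis is load-bearing for truth,
# and the SHAPE of a counterexample (standing disprover, cycle 1)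

The crux `C` (shared verbatim by routes FrozenTwin, ToricShedding, DefiniteTheta) is
`∀ W [IsElliptic] [IsGloballyMinimal], (¬ ∃ q prime, multiplicative at q) → ∀ p prime, 5 ≤ p →
good at p → ¬ p ∣ a_p → ρ̄_{W,p} onto → W.selmerCorank p ≤ W.analyticRank`.
This file records, as kernel-checked theorems that assert NO route statement positively and
introduce no definition:

* `UBPotentiallyGoodNegative.hypotheses_unsatisfiable_of_hasCM` — on a CM curve the hypothesis block
  is unsatisfiable (no `p ≥ 5` good ordinary with `ρ̄` onto; Serre 1972 §4.5, tree theorem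
  `not_hasSurjectiveModNGaloisRep_of_hasCM_of_not_dvd_frobeniusTrace`; with the tree's
  `not_hasCM_of_hasSurjectiveModNGaloisRep_of_five_le` every violating pair is NON-CM — the crux is
  its own non-CM part and lines need no CM branch).
* `UBPotentiallyGoodNegative.strengthening_exists_admissible_false` — but the CM sub-sector is real:
  "every sector curve has an admissible prime" is FALSE (`32a2`, landed TamePinch/PGSelmerBSD lemmas).
* `UBPotentiallyGoodNegative.not_summit_and_shaPFinite_of_not` — a counterexample refutes
  `BirchSwinnertonDyer ∧ SelmerRankShaPFinite` (Greenberg's PROVED identity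
  `corank Sel_{p^∞} = rank + corank Ш[p^∞]`); so no `_false_without_<H>` lemma exists for any of the
  six hypotheses short of that, and the crux cannot be "refuted-misstated" on their account.
* `UBPotentiallyGoodNegative.exists_infinite_sha_of_summit_of_not` — given the summit, a
  counterexample is an admissible pair with INFINITE `Ш(W)[p^∞]`.
* `UBPotentiallyGoodNegative.cex_dichotomy` (unconditional: excess rank or `corank Ш[p^∞] ≥ 1`),
  `UBPotentiallyGoodNegative.cex_shape` (mod GZK + `p`-parity: `r_an ≥ 2`, `corank_p ≥ r_an + 2 ≥ 4`),
  `UBPotentiallyGoodNegative.two_le_shaCorank_of_rank_le` (if `rank ≤ r_an` there, `corank Ш[p^∞] ≥ 2`),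
  `UBPotentiallyGoodNegative.exists_witness_of_not` (the Σ-shape of `¬C`: non-CM sector curve,
  admissible `p`, `r_an ≥ 2`, `corank_p ≥ r_an + 2 ≥ 4`).
* `UBPotentiallyGoodNegative.analyticRank_eq_zero_of_not_analyticAt`,
  `UBPotentiallyGoodNegative.analyticRank_eq_zero_of_eventuallyEq_zero` — the two junk branches of
  `analyticRank` both give `0` (they work AGAINST the crux and are excluded only by modularity /
  `a₁ = 1`, which a prover must therefore invoke).
Full adversarial record: `Cruxes/UBPotentiallyGood/Disproof.lean`.
Refuter seat refuter-cdisprove-stmt-BirchSwinnertonDyer-15878-0, 2026-08-17.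
-/

set_option linter.dupNamespace false

noncomputable section

open scoped Classical Topology

namespace Summit.BirchSwinnertonDyer.BirchSwinnertonDyer.Theorems

open Filter
open Summit.BirchSwinnertonDyer.BirchSwinnertonDyer.Theses
open Literature.NumberTheory.EllipticCurves WeierstrassCurve

/-! ### Vacuity on CM curves -/

/-- **On a CM curve the hypothesis block of `UBPotentiallyGood` is unsatisfiable**: no prime `p ≥ 5`
of good ordinary reduction has `ρ̄_{W,p}` onto (the image normalises a Cartan subgroup).
[cite: Serre1972, §4.5] -/
theorem UBPotentiallyGoodNegative.hypotheses_unsatisfiable_of_hasCM (W : WeierstrassCurve ℚ)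
    [W.IsElliptic] [W.IsGloballyMinimal] (hCM : W.HasCM) (p : ℕ) [Fact p.Prime] (h5 : 5 ≤ p)
    (hgood : W.HasGoodReductionAtPrime p) (hord : ¬ (p : ℤ) ∣ W.frobeniusTrace p) :
    ¬ W.HasSurjectiveModNGaloisRep p :=
  not_hasSurjectiveModNGaloisRep_of_hasCM_of_not_dvd_frobeniusTrace W hCM p (by omega) hgood hord

-- Every pair `(W,p)` satisfying the hypotheses is NON-CM: this is the tree theorem
-- `Literature.NumberTheory.EllipticCurves.not_hasCM_of_hasSurjectiveModNGaloisRep_of_five_le`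
-- (used below in `exists_witness_of_not`); so the crux is its own non-CM part, provers may assume
-- `¬ W.HasCM` at no cost, and the CM crux `SelmerRankCM` (stmt-18086) is logically disjoint from it.

/-- **The CM sub-sector is real, so the vacuity bites: FALSE strengthening** "every curve of the
sector (elliptic, globally minimal, no multiplicative prime) HAS an admissible prime `p ≥ 5` (good
ordinary, `ρ̄` onto)". Witness `32a2 : y² = x³ − x` (`j = 1728`, CM by `ℤ[i]`, in the sector by the
landed `PGSelmerBSDNegative.thirtyTwoA2_no_multiplicative_prime`; no odd surjective prime by the
landed `tamePinch_not_hasSurjectiveModNGaloisRep_quartic`). Hence an assembly can feed only NON-CM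
sector curves through the crux. [cite: Serre1972, §4.5] -/
theorem UBPotentiallyGoodNegative.strengthening_exists_admissible_false :
    ¬ ∀ (W : WeierstrassCurve ℚ) [W.IsElliptic] [W.IsGloballyMinimal],
        (¬ ∃ (q : ℕ) (_ : Fact q.Prime), W.HasMultiplicativeReductionAtPrime q) →
          ∃ (p : ℕ) (_ : Fact p.Prime), 5 ≤ p ∧ W.HasGoodReductionAtPrime p ∧
            ¬ (p : ℤ) ∣ W.frobeniusTrace p ∧ W.HasSurjectiveModNGaloisRep p := by
  intro h
  obtain ⟨p, hp, h5, -, -, hsurj⟩ := @h ⟨0, 0, 0, -1, 0⟩ (isElliptic_quartic (by norm_num))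
    tamePinch_isGloballyMinimal_thirtyTwoA2 PGSelmerBSDNegative.thirtyTwoA2_no_multiplicative_prime
  exact tamePinch_not_hasSurjectiveModNGaloisRep_quartic (D := -1) (by norm_num) p (by omega) hsurj

/-! ### No hypothesis is load-bearing for truth -/

/-- **A counterexample to `UBPotentiallyGood` refutes `BirchSwinnertonDyer ∧ SelmerRankShaPFinite`.**
Indeed the hypothesis-free inequality `corank_p Sel_{p^∞}(W) ≤ r_an(W)` at EVERY elliptic `W/ℚ` and
EVERY prime already follows from BSD-rank and finiteness of `Ш(W)[p^∞]`, by the PROVED identity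
`corank Sel_{p^∞} = rank + corank Ш[p^∞]` (`selmerCorank_eq_mordellWeilRank_add_holds`). Consequence:
none of the six hypotheses (global minimality, sector, `5 ≤ p`, good, ordinary, surjective) admits a
`_false_without_<H>` lemma short of refuting that conjunction. [cite: GreenbergLNM1716, §1] -/
theorem UBPotentiallyGoodNegative.not_summit_and_shaPFinite_of_not (h : ¬ FrozenTwin.UBPotentiallyGood) :
    ¬ (_root_.BirchSwinnertonDyer ∧ FrozenTwin.SelmerRankShaPFinite) := by
  rintro ⟨hS, hSha⟩
  apply h
  intro W _ _ _ p _ _ _ _ _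
  have h1 := W.selmerCorank_eq_mordellWeilRank_add_holds p
  have h2 : W.shaCorank p = 0 := Literature.BSD.shaCorank_eq_zero_of_finite W p (hSha W p)
  have h3 : W.analyticRank = W.mordellWeilRank :=
    (show ∀ V : WeierstrassCurve ℚ, V.IsElliptic → V.analyticRank = V.mordellWeilRank from hS) W ‹_›
  omega

/-- **Given the summit, a counterexample is an admissible pair with INFINITE `Ш(W)[p^∞]`** (positive
corank, unconditionally in `S`). [cite: GreenbergLNM1716, §1] -/
theorem UBPotentiallyGoodNegative.exists_infinite_sha_of_summit_of_not (hS : _root_.BirchSwinnertonDyer)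
    (h : ¬ FrozenTwin.UBPotentiallyGood) :
    ∃ (W : WeierstrassCurve ℚ) (_ : W.IsElliptic) (_ : W.IsGloballyMinimal) (p : ℕ) (_ : Fact p.Prime),
      (¬ ∃ (q : ℕ) (_ : Fact q.Prime), W.HasMultiplicativeReductionAtPrime q) ∧ 5 ≤ p ∧
        W.HasGoodReductionAtPrime p ∧ ¬ (p : ℤ) ∣ W.frobeniusTrace p ∧ W.HasSurjectiveModNGaloisRep p ∧
          1 ≤ W.shaCorank p ∧ ¬ Finite ↥(AddCommGroup.primaryComponent W.sha p) := by
  by_contra hno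
  apply h
  intro W _ _ hpg p _ h5 hg ho hs
  by_contra hlt
  have h1 := W.selmerCorank_eq_mordellWeilRank_add_holds p
  have h3 : W.analyticRank = W.mordellWeilRank :=
    (show ∀ V : WeierstrassCurve ℚ, V.IsElliptic → V.analyticRank = V.mordellWeilRank from hS) W ‹_›
  have hsha : 1 ≤ W.shaCorank p := by omega
  have hfin : ¬ Finite ↥(AddCommGroup.primaryComponent W.sha p) := by
    intro hfin
    have h2 : W.shaCorank p = 0 := Literature.BSD.shaCorank_eq_zero_of_finite W p hfin
    omega
  exact hno ⟨W, ‹_›, ‹_›, p, ‹_›, hpg, h5, hg, ho, hs, hsha, hfin⟩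

/-! ### Shape of a counterexample -/

/-- **Unconditional dichotomy.** At a violating pair `(W,p)`: BSD-rank fails at `W` by EXCESS rank
(`rank > r_an`), or `Ш(W)[p^∞]` has positive corank. [cite: GreenbergLNM1716, §1] -/
theorem UBPotentiallyGoodNegative.cex_dichotomy (W : WeierstrassCurve ℚ) [W.IsElliptic] (p : ℕ)
    [Fact p.Prime] (h : ¬ W.selmerCorank p ≤ W.analyticRank) :
    W.analyticRank < W.mordellWeilRank ∨ 1 ≤ W.shaCorank p := by
  have h1 := W.selmerCorank_eq_mordellWeilRank_add_holds p
  omega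

/-- **Shape modulo Gross–Zagier–Kolyvagin and `p`-parity** (named facts of the tree, as hypotheses):
a violating pair has `r_an ≥ 2` and `corank_p ≥ r_an + 2 ≥ 4`. So the crux is a theorem for
`corank_p ≤ 3`, open exactly from the cells `(corank_p, r_an) ∈ {(4,2), (5,3), (6,2), (6,4), …}`.
[cite: Darmon2004, Thm. 3.22] [cite: DokchitserDokchitserAnnals2010, Thm. 1.4] -/
theorem UBPotentiallyGoodNegative.cex_shape (hGZK : rank_eq_analyticRank_of_analyticRank_le_one)
    (hPar : ∀ (W : WeierstrassCurve ℚ) [W.IsElliptic] (p : ℕ) [Fact p.Prime], selmerCorank_mod_two_eq W p)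
    (W : WeierstrassCurve ℚ) [W.IsElliptic] (p : ℕ) [Fact p.Prime]
    (h : ¬ W.selmerCorank p ≤ W.analyticRank) :
    2 ≤ W.analyticRank ∧ W.analyticRank + 2 ≤ W.selmerCorank p ∧ 4 ≤ W.selmerCorank p := by
  have hr : 2 ≤ W.analyticRank := by
    by_contra hlt
    exact h (selmerCorank_eq_analyticRank_of_analyticRank_le_one hGZK W p (by omega)).le
  have hpar : W.selmerCorank p % 2 = W.analyticRank % 2 := hPar W p
  refine ⟨hr, ?_, ?_⟩ <;> omega

/-- **Where excess rank is excluded, `Ш` must be wild**: if `rank W ≤ r_an W` at a violating pair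
(true under the summit, and wherever `rank = r_an` is certified) then `corank Ш(W)[p^∞] ≥ 2`,
i.e. `(ℚ_p/ℤ_p)² ⊆ Ш(W/ℚ)`. [cite: DokchitserDokchitserAnnals2010, Thm. 1.4] -/
theorem UBPotentiallyGoodNegative.two_le_shaCorank_of_rank_le
    (hPar : ∀ (W : WeierstrassCurve ℚ) [W.IsElliptic] (p : ℕ) [Fact p.Prime], selmerCorank_mod_two_eq W p)
    (W : WeierstrassCurve ℚ) [W.IsElliptic] (p : ℕ) [Fact p.Prime]
    (hrank : W.mordellWeilRank ≤ W.analyticRank) (h : ¬ W.selmerCorank p ≤ W.analyticRank) :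
    2 ≤ W.shaCorank p := by
  have h1 := W.selmerCorank_eq_mordellWeilRank_add_holds p
  have hpar : W.selmerCorank p % 2 = W.analyticRank % 2 := hPar W p
  omega

/-- **The Σ-shape of `¬ UBPotentiallyGood`** (modulo GZK and `p`-parity): a NON-CM curve of the
sector in global minimal form and an admissible prime `p ≥ 5` with `r_an ≥ 2` and
`corank_p ≥ r_an + 2 ≥ 4` — what any refutation or certificate must exhibit. No construction,
heuristic or numerical signature of such a pair is known; Kato gives only `corank_p ≤ ord_T L_p`, so
computation can confirm instances but never refute. [cite: Darmon2004, Thm. 3.22]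
[cite: DokchitserDokchitserAnnals2010, Thm. 1.4] [cite: Serre1972, §4.5] -/
theorem UBPotentiallyGoodNegative.exists_witness_of_not
    (hGZK : rank_eq_analyticRank_of_analyticRank_le_one)
    (hPar : ∀ (W : WeierstrassCurve ℚ) [W.IsElliptic] (p : ℕ) [Fact p.Prime], selmerCorank_mod_two_eq W p)
    (h : ¬ FrozenTwin.UBPotentiallyGood) :
    ∃ (W : WeierstrassCurve ℚ) (_ : W.IsElliptic) (_ : W.IsGloballyMinimal) (p : ℕ) (_ : Fact p.Prime),
      ¬ W.HasCM ∧ (¬ ∃ (q : ℕ) (_ : Fact q.Prime), W.HasMultiplicativeReductionAtPrime q) ∧ 5 ≤ p ∧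
        W.HasGoodReductionAtPrime p ∧ ¬ (p : ℤ) ∣ W.frobeniusTrace p ∧ W.HasSurjectiveModNGaloisRep p ∧
          2 ≤ W.analyticRank ∧ W.analyticRank + 2 ≤ W.selmerCorank p ∧ 4 ≤ W.selmerCorank p := by
  by_contra hno
  apply h
  intro W _ _ hpg p _ h5 hg ho hs
  by_contra hlt
  have hCM := not_hasCM_of_hasSurjectiveModNGaloisRep_of_five_le W p h5 hg ho hs
  obtain ⟨h2, h3, h4⟩ := UBPotentiallyGoodNegative.cex_shape hGZK hPar W p hlt
  exact hno ⟨W, ‹_›, ‹_›, p, ‹_›, hCM, hpg, h5, hg, ho, hs, h2, h3, h4⟩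

/-! ### The two junk branches of `analyticRank` -/

/-- Junk branch 1: if `W.entireLFunction` is not analytic at `1` (possible only when `L(W,s)` has no
entire continuation), `analyticRank W = 0` — AGAINST the crux at any positive-corank curve; excluded by
modularity (`hasEntireLFunction_rat`), which a prover must therefore invoke.
[cite: BCDTJAMS2001, Theorem A] -/
theorem UBPotentiallyGoodNegative.analyticRank_eq_zero_of_not_analyticAt (W : WeierstrassCurve ℚ)
    (h : ¬ AnalyticAt ℂ W.entireLFunction 1) : W.analyticRank = 0 :=
  analyticOrderNatAt_of_not_analyticAt h

/-- Junk branch 2: if `L(W,s)` vanished identically near `s = 1`, `analyticOrderAt = ⊤` and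
`analyticRank W = 0` — again AGAINST the crux; excluded by `a₁ = 1`
(`entireLFunction_not_eventuallyEq_zero`). [cite: SilvermanAEC2009, App. C §16] -/
theorem UBPotentiallyGoodNegative.analyticRank_eq_zero_of_eventuallyEq_zero (W : WeierstrassCurve ℚ)
    (h : ∀ᶠ s in 𝓝 (1 : ℂ), W.entireLFunction s = 0) : W.analyticRank = 0 := by
  show (analyticOrderAt W.entireLFunction 1).toNat = 0
  rw [analyticOrderAt_eq_top.mpr h]
  rfl

end Summit.BirchSwinnertonDyer.BirchSwinnertonDyer.Theorems

end
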